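import Summits.NavierStokesRegularity.NavierStokesRegularity.Theorems.ExtremiserTransienceKStarAttainedHalfSpaceVariation
import HarnessLib

/-!
# Route `ExtremiserTransience`, crux `RegularisedNearPlateauStability` (stmt-NavierStokesRegularity-28317),
# LINE g6-γ «bang-bang core»: SLACK FERMAT (the elementary core of K1)

`--supports stmt-NavierStokesRegularity-28317` (helper). Author: prover seat `ns-net-p2` (g0).

The bang-bang mechanism bounds the first variation `ℓ = c₁` of `f(s) = J(v+sφ)² − κ⋆²M²Z(v+sφ)W(v+sφ) = Σ_{k≤6} c_k s^k`
from the two facts `f ≤ 0` on `|s| ≤ s₀` (universality of `κ⋆` while `‖v + sφ‖ ≤ M`) and `f(0) ≥ −δ` (near-efficiency).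
This file isolates the real-variable inequality (the tree's `KStar.HalfSpace.linear_coeff_le_of_sq_le_oneSided` is the
exact case `δ = 0`, via the derivative at `0`):

* `abs_linear_coeff_le_of_nonpos` — if `|p(s) − c₀ − c₁ s| ≤ S s²` and `p(s) ≤ 0` for `|s| ≤ s₀` (`s₀ > 0`) and `c₀ ≥ −δ`,
  then `|c₁| ≤ 2√(δS) + 2δ/s₀` (optimise `δ/s + S s` over `s ∈ (0, s₀]`);
* `abs_sextic_sub_le` — for the sextic `Σ_{k≤6} c_k s^k` the remainder constant is `S = Σ_{k=2}^{6} |c_k| s₀^{k−2}`;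
* `abs_linear_coeff_le_of_sextic_nonpos` — the two combined.

HONEST SCOPE (see the evidence note `K14-analysis.md` on items 28317 / 26567): with the honest sizes `δ = 2κ⋆εM²ZW = 2κ⋆εN·u`,
`S ≍ C(A,D,R₀)τ^{-4}·u` (`u = M⁴Wλ`, `N = λW/M²` the cell number) this yields `|ℓ| ≲ (√(εN) + εN)·u`, NOT the N-free bound
of the registered stub `stub_localBangBang`; nothing here asserts that stub. No Navier–Stokes statement is proved here;
no summit is proved by a line. [folklore]
-/

noncomputable section

namespace Summit.NavierStokesRegularity.NavierStokesRegularity.Theorems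

-- the problem directory repeats the summit name (`NavierStokesRegularity/NavierStokesRegularity`)
set_option linter.dupNamespace false

namespace DepletionLadder.KStar.BangBang

/-- **Slack Fermat.** If `p ≤ 0` on `[-s₀, s₀]` (`s₀ > 0`), `|p(s) − c₀ − c₁ s| ≤ S·s²` there, and `c₀ ≥ −δ`, then
`|c₁| ≤ 2√(δ·S) + 2δ/s₀`. (For `0 < s ≤ s₀`: `±c₁ s ≤ −c₀ + S s² ≤ δ + S s²`; optimise over `s`.) [folklore] -/
theorem abs_linear_coeff_le_of_nonpos {p : ℝ → ℝ} {c₀ c₁ S δ s₀ : ℝ} (hs₀ : 0 < s₀) (hδ : -δ ≤ c₀)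
    (hp : ∀ s, |s| ≤ s₀ → |p s - c₀ - c₁ * s| ≤ S * s ^ 2) (hle : ∀ s, |s| ≤ s₀ → p s ≤ 0) :
    |c₁| ≤ 2 * Real.sqrt (δ * S) + 2 * δ / s₀ := by
  -- `|c₁| ≤ δ/s + S s` on `(0, s₀]`
  have key : ∀ s, 0 < s → s ≤ s₀ → |c₁| * s ≤ δ + S * s ^ 2 := by
    intro s hs hss₀
    have h1 : ∀ t, |t| ≤ s₀ → c₁ * t ≤ δ + S * t ^ 2 := by
      intro t ht
      have ha := hp t ht
      have hb := hle t ht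
      have hc : -(S * t ^ 2) ≤ p t - c₀ - c₁ * t := (abs_le.1 ha).1
      linarith
    have hs' : |s| ≤ s₀ := by rw [abs_of_pos hs]; exact hss₀
    have hns : |(-s)| ≤ s₀ := by rw [abs_neg, abs_of_pos hs]; exact hss₀
    have hpos := h1 s hs'
    have hneg := h1 (-s) hns
    rw [neg_sq] at hneg
    rcases le_or_gt 0 c₁ with hc | hc
    · rw [abs_of_nonneg hc]; linarith
    · rw [abs_of_neg hc]; linarith
  -- `δ ≥ 0` and `S ≥ 0` are forced
  have hp0 : p 0 = c₀ := by
    have h := hp 0 (by rw [abs_zero]; exact hs₀.le)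
    have h' : |p 0 - c₀| ≤ 0 := by simpa using h
    have h'' : p 0 - c₀ = 0 := abs_eq_zero.1 (le_antisymm h' (abs_nonneg _))
    linarith
  have hδ0 : 0 ≤ δ := by
    have := hle 0 (by rw [abs_zero]; exact hs₀.le)
    linarith
  have hS0 : 0 ≤ S := by
    by_contra hS
    have hneg : S * s₀ ^ 2 < 0 := mul_neg_of_neg_of_pos (not_le.1 hS) (pow_pos hs₀ 2)
    have h := hp s₀ (by rw [abs_of_pos hs₀])
    linarith [abs_nonneg (p s₀ - c₀ - c₁ * s₀)]
  have hsq0 : 0 ≤ Real.sqrt (δ * S) := Real.sqrt_nonneg _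
  rcases le_or_gt δ (S * s₀ ^ 2) with hcase | hcase
  · -- interior optimum `s = √(δ/S)` (if `δ = 0` then `c₁ = 0`)
    rcases hδ0.eq_or_lt with hδz | hδpos
    · -- δ = 0
      subst hδz
      have hc : |c₁| ≤ 0 := by
        by_contra hc
        have hcpos : 0 < |c₁| := lt_of_not_ge hc
        rcases hS0.eq_or_lt with hSz | hSpos
        · have h := key s₀ hs₀ le_rfl
          rw [← hSz] at h
          nlinarith
        · set s := min s₀ (|c₁| / (2 * S)) with hs
          have hspos : 0 < s := lt_min hs₀ (by positivity)
          have h := key s hspos (min_le_left _ _)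
          have hsle : s ≤ |c₁| / (2 * S) := min_le_right _ _
          have : S * s ≤ |c₁| / 2 := by
            calc S * s ≤ S * (|c₁| / (2 * S)) := by gcongr
              _ = |c₁| / 2 := by field_simp
          nlinarith
      have : |c₁| = 0 := le_antisymm hc (abs_nonneg _)
      rw [this]; positivity
    · have hSpos : 0 < S := by
        by_contra hS
        have : S = 0 := le_antisymm (not_lt.1 hS) hS0
        rw [this, zero_mul] at hcase
        linarith
      set s := Real.sqrt (δ / S) with hs
      have hspos : 0 < s := Real.sqrt_pos.2 (div_pos hδpos hSpos)
      have hs2 : s ^ 2 = δ / S := Real.sq_sqrt (div_pos hδpos hSpos).le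
      have hss₀ : s ≤ s₀ := by
        have : s ^ 2 ≤ s₀ ^ 2 := by rw [hs2, div_le_iff₀ hSpos]; linarith
        nlinarith [hs₀]
      have h := key s hspos hss₀
      -- `|c₁| ≤ δ/s + S s = 2 √(δ S)`
      have hδeq : δ = S * s ^ 2 := by
        rw [hs2]; exact (mul_div_cancel₀ δ hSpos.ne').symm
      have hSs : (S * s) ^ 2 = δ * S := by rw [hδeq]; ring
      have hprod : Real.sqrt (δ * S) = S * s := by rw [← hSs, Real.sqrt_sq (by positivity)]
      have h2 : |c₁| * s ≤ 2 * (S * s) * s := by rw [hδeq] at h; linarith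
      have h3 : |c₁| ≤ 2 * (S * s) := le_of_mul_le_mul_right (by linarith) hspos
      rw [hprod]
      have : 0 ≤ 2 * δ / s₀ := by positivity
      linarith
  · -- boundary optimum `s = s₀`
    have h := key s₀ hs₀ le_rfl
    have h2 : |c₁| * s₀ ≤ 2 * δ := by nlinarith
    have h3 : |c₁| ≤ 2 * δ / s₀ := by rw [le_div_iff₀ hs₀]; linarith
    linarith

/-- Remainder of a sextic beyond its linear part on `|s| ≤ s₀`:
`|Σ_{k≤6} c_k s^k − c₀ − c₁ s| ≤ (Σ_{k=2}^{6} |c_k| s₀^{k−2})·s²`. [folklore] -/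
theorem abs_sextic_sub_le {c₀ c₁ c₂ c₃ c₄ c₅ c₆ s₀ s : ℝ} (hs : |s| ≤ s₀) :
    |c₀ + c₁ * s + c₂ * s ^ 2 + c₃ * s ^ 3 + c₄ * s ^ 4 + c₅ * s ^ 5 + c₆ * s ^ 6 - c₀ - c₁ * s| ≤
      (|c₂| + |c₃| * s₀ + |c₄| * s₀ ^ 2 + |c₅| * s₀ ^ 3 + |c₆| * s₀ ^ 4) * s ^ 2 := by
  have hrew : c₀ + c₁ * s + c₂ * s ^ 2 + c₃ * s ^ 3 + c₄ * s ^ 4 + c₅ * s ^ 5 + c₆ * s ^ 6 - c₀ - c₁ * s =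
      (c₂ + c₃ * s + c₄ * s ^ 2 + c₅ * s ^ 3 + c₆ * s ^ 4) * s ^ 2 := by ring
  rw [hrew, abs_mul, abs_of_nonneg (sq_nonneg s)]
  gcongr
  calc |c₂ + c₃ * s + c₄ * s ^ 2 + c₅ * s ^ 3 + c₆ * s ^ 4|
      ≤ |c₂ + c₃ * s + c₄ * s ^ 2 + c₅ * s ^ 3| + |c₆ * s ^ 4| := abs_add_le _ _
    _ ≤ |c₂ + c₃ * s + c₄ * s ^ 2| + |c₅ * s ^ 3| + |c₆ * s ^ 4| := by
        linarith [abs_add_le (c₂ + c₃ * s + c₄ * s ^ 2) (c₅ * s ^ 3)]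
    _ ≤ |c₂ + c₃ * s| + |c₄ * s ^ 2| + |c₅ * s ^ 3| + |c₆ * s ^ 4| := by
        linarith [abs_add_le (c₂ + c₃ * s) (c₄ * s ^ 2)]
    _ ≤ |c₂| + |c₃ * s| + |c₄ * s ^ 2| + |c₅ * s ^ 3| + |c₆ * s ^ 4| := by
        linarith [abs_add_le c₂ (c₃ * s)]
    _ = |c₂| + |c₃| * |s| + |c₄| * |s| ^ 2 + |c₅| * |s| ^ 3 + |c₆| * |s| ^ 4 := by
        simp only [abs_mul, abs_pow]
    _ ≤ |c₂| + |c₃| * s₀ + |c₄| * s₀ ^ 2 + |c₅| * s₀ ^ 3 + |c₆| * s₀ ^ 4 := by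
        gcongr

/-- **Slack Fermat for a sextic** (the shape of `f(s) = J(v+sφ)² − κ⋆²M²Z(v+sφ)W(v+sφ)`): if
`Σ_{k≤6} c_k s^k ≤ 0` for `|s| ≤ s₀` (`s₀ > 0`) and `c₀ ≥ −δ`, then
`|c₁| ≤ 2√(δ·S) + 2δ/s₀` with `S = Σ_{k=2}^{6}|c_k| s₀^{k−2}`. [folklore] -/
theorem abs_linear_coeff_le_of_sextic_nonpos {c₀ c₁ c₂ c₃ c₄ c₅ c₆ s₀ δ : ℝ} (hs₀ : 0 < s₀) (hδ : -δ ≤ c₀)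
    (hle : ∀ s, |s| ≤ s₀ → c₀ + c₁ * s + c₂ * s ^ 2 + c₃ * s ^ 3 + c₄ * s ^ 4 + c₅ * s ^ 5 + c₆ * s ^ 6 ≤ 0) :
    |c₁| ≤ 2 * Real.sqrt (δ * (|c₂| + |c₃| * s₀ + |c₄| * s₀ ^ 2 + |c₅| * s₀ ^ 3 + |c₆| * s₀ ^ 4)) + 2 * δ / s₀ :=
  abs_linear_coeff_le_of_nonpos (p := fun s => c₀ + c₁ * s + c₂ * s ^ 2 + c₃ * s ^ 3 + c₄ * s ^ 4 + c₅ * s ^ 5 +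
    c₆ * s ^ 6) hs₀ hδ (fun _ hs => abs_sextic_sub_le hs) hle

end DepletionLadder.KStar.BangBang

end Summit.NavierStokesRegularity.NavierStokesRegularity.Theorems

end
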